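import Summits.QuantumFields.BalabanUV.Beta.EriceFlowEnclosureB12AsPrintedLower
import Literature.MathematicalPhysics.QuantumFieldTheory.Balaban1983to89.FlowStepRuns

/-!
# Beta / EriceFlowEnclosureB12AsPrintedLowerEnd — the LOWER ∕ POSITIVITY side on the as-printed carrier of [I], part 2: the interval clause of
# Theorem 2 is CARRIED by (0.31) (a γ-free equivalent form of `Theorem2Statement`); Theorem 2's FIRST SENTENCE from partial-sum positivity;
# prover 1's binder `hrg` from the halting normalisation (β-flow team, prover 2, unit `b2b-balaban-beta-bflow-p2`, gen 40; ROW AP-I, lower half;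
# part 1 = `…B12AsPrintedLower`)

HONEST FRAMING (page 1 of everything the β sub-cell writes): discharging `BetaPertH` makes Bałaban's UV stability UNCONDITIONAL — a
real constructive-QFT result; it is NOT the continuum limit and NOT the Clay problem.  HONEST DEPENDENCY (cell reorg 2026-08-19,
verbatim): «continuum YM on T⁴ ⇐ BetaPertH ∧ nine spine estimates (0/9 proved); BetaPertH ⇐ (D1) ∧ (D4) ∧ CAP+tail; G-an2-4 gates
asym, D1 and NE2/3/4.»  THIS MODULE DISCHARGES NOTHING: bookkeeping over the NAMED FIELDS of `B12BetaAsPrinted` ([I] = [Balaban1987RG1] as typed,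
p537882 ✓ ∕ v1.1 p539116 ✓): `Theorem2Statement S hL` (Theorem 2 ∕ (0.31), STATED WITHOUT PROOF in print — a HYPOTHESIS or a CONCLUSION SHAPE here,
never asserted), `Definitions S` ((0.18) `d018`, the forward-determination form (0.20) `d020`), and the tree's located UNPRINTED letters on the
history-typed β (`FlowStep.BetaContH` ∕ `BetaUpperH` ∕ `BetaLowerH`, `FlowStepRuns.BetaPartialSumsLowerH`) as displayed hypotheses.  Nothing of
[I] is asserted; no field is claimed for Bałaban's objects.

WHAT THIS FILE PROVES (0 sorry, 0 def):
§3 **`theorem2Statement_iff_noInterval`** — ON THE AS-PRINTED CARRIER, THEOREM 2 IS EQUIVALENT TO ITS γ-FREE FORM: «for every m there is g₁ > 0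
   such that for every g ∈ ]0, g₁] there are 0 < β ≤ β′ with, at every K, a bare coupling whose run is POSITIVE, ends at g_K = g and obeys (0.31)
   per step».  The printed clause *"let γ be a sufficiently small positive constant … the sequence of the effective coupling constants g_k is
   contained in the interval ]0, γ]"* is CARRIED by the left inequality of (0.31) (β ≥ 0 ⟹ g_k ≤ g, part 1's `le_final_of_discrete031_lower`):
   [Balaban1989LargeFieldII] p. 355 *"this assumption follows from the basic inequality (0.31)"* as an equivalence of statements.
§4 **`firstSentence_of_partialSums`** — THEOREM 2's FIRST SENTENCE (*"for a sufficiently small positive g there exists a bare coupling constant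
   g₀ = g₀(ε, g) such that the sequence … is contained in the interval ]0, γ], and g_K = g"*) ON THIS CARRIER FROM THE WEAKEST LOCATED LETTER:
   `Definitions S` + joint continuity + an upper bound β′ + PARTIAL-SUM positivity `Σ_{j∈[k,n)} β_{j+1}(g₀, …, g_j) ≥ −M` on the boxes ]0, γ₀]^{k+1}
   (`FlowStepRuns.BetaPartialSumsLowerH`; no sign of β — `FlowStepRuns.sign_not_necessary`) ⟹ for γ ≤ γ₀, every g > 0 with `1∕g² ≥ 1∕γ² + M` and
   every K a bare coupling g₀ with the run in ]0, γ], g_K = g, (0.20) ALONG IT (`FlowStep.RGEqH` — derived here, by forward uniqueness), and the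
   DEFECTED two-sided running `1∕g² − M ≤ 1∕g_k² ≤ 1∕g² + β′(K − k)` (forward shooting `FlowStepRuns.couplingTrajectory_exists_partialSums` +
   forward uniqueness `FlowStepRuns.flow_eq_of_rgEqH`, fed by `d018` ∕ `d020`); `endpoint_of_partialSums` (Theorem 2's quantifier shape, g₁ =
   (1∕γ² + M)^{−1∕2}); `endpoint_of_sign` (the SIGN `β ≥ 0` on the boxes: every g ∈ ]0, γ], and then g_k ≤ g along the run).
§5 **`rgEqH_of_inInterval_of_halts`** — prover 1's located binder `hrg` («inside the interval the couplings obey (0.20)», `…B12AsPrintedTuned`)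
   FOLLOWS from `Definitions.d020` + the HALTING NORMALISATION `hhalt` («where (0.20) has no positive solution the table holds a non-positive
   value» — the carrier-level form of `FlowStepRuns.HaltsOutside`, a typing convention for runs print does not discuss, DELTA-I D-4); hence
   `hrg_of_halts` and part 1's necessity headline under the halting clause, `theorem2Statement_forces_suffix_of_halts`.
NOT CLAIMED: `hhalt` or any interface field for the construction; the letters; Theorem 2; `BetaPertH`; continuum; Clay.
-/

namespace Summit.QuantumFields.BalabanUV.Beta.EriceFlowEnclosureB12AsPrintedLowerEnd

open Literature.MathematicalPhysics.QuantumFieldTheory.Balaban1983to89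
open Literature.MathematicalPhysics.QuantumFieldTheory.Balaban1983to89.B12BetaAsPrinted
open Literature.MathematicalPhysics.QuantumFieldTheory.Balaban1983to89.B12Sec2to5 (betaPrime510)
open Literature.MathematicalPhysics.QuantumFieldTheory.Balaban1983to89.FlowStep (prefixOf Box BetaContH BetaLowerH BetaUpperH
  box_mono)
open Literature.MathematicalPhysics.QuantumFieldTheory.Balaban1983to89.FlowStepRuns (BetaPartialSumsLowerH
  betaPartialSumsLowerH_mono betaPartialSumsLowerH_of_sign couplingTrajectory_exists_partialSums flow_eq_of_rgEqH)
open Summit.QuantumFields.BalabanUV.Beta.EriceFlowEnclosureB12AsPrintedUpper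
open Summit.QuantumFields.BalabanUV.Beta.EriceFlowEnclosureB12AsPrintedTuned
open Summit.QuantumFields.BalabanUV.Beta.EriceFlowEnclosureB12AsPrintedLower

noncomputable section

variable {S : Setting}

/-! ## §3 The interval clause of Theorem 2 is carried by (0.31): a γ-free equivalent form on the as-printed carrier -/

/-- **[I] THEOREM 2 AS PRINTED ⟺ ITS γ-FREE FORM, on the as-printed carrier.**  `Theorem2Statement S hL` (verbatim: *"let γ be a sufficiently
small positive constant, then for a sufficiently small positive g there exists a bare coupling constant g₀ = g₀(ε, g) such that the sequence of
the effective coupling constants g_k is contained in the interval ]0, γ], and g_K = g. Moreover … (0.31)"*) is EQUIVALENT to: for every m there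
is g₁ > 0 such that for every g ∈ ]0, g₁] there are constants 0 < β ≤ β′ such that at every K some bare coupling gives a run with `g_k > 0`
(k ≤ K), `g_K = g` and the per-step (0.31) `1∕g² + β ln L·(K − k) ≤ 1∕g_k² ≤ 1∕g² + β′ ln L·(K − k)`.  (⟸: with β ≥ 0 the left inequality gives
g_k ≤ g — part 1's `le_final_of_discrete031_lower` — so for g ≤ γ the run lies in ]0, γ]; take γ₀ := g₁ and, given γ ≤ γ₀, the threshold γ for
g.)  [Balaban1989LargeFieldII] p. 355: *"this assumption follows from the basic inequality (0.31)"*. [cite: Balaban1987RG1, Thm 2 (0.31) p.259; Balaban1989LargeFieldII, Thm 1 p.355] -/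
theorem theorem2Statement_iff_noInterval {hL : Odd S.L ∧ 1 < S.L} :
    Theorem2Statement S hL ↔
      ∀ m : ℕ, ∃ g₁ : ℝ, 0 < g₁ ∧ ∀ g : ℝ, 0 < g → g ≤ g₁ →
        ∃ β β' : ℝ, 0 < β ∧ β ≤ β' ∧ ∀ K : ℕ, ∃ g₀ : ℝ,
          (∀ k, k ≤ K → 0 < S.cpl ⟨K, m, g₀⟩ k) ∧ S.cpl ⟨K, m, g₀⟩ K = g ∧
            Step.Discrete031 (β * Real.log S.L) (β' * Real.log S.L) K g (S.cpl ⟨K, m, g₀⟩) := by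
  have hlog : 0 < Real.log (S.L : ℝ) := Real.log_pos (by exact_mod_cast hL.2)
  constructor
  · intro h m
    obtain ⟨γ₀, hγ₀, hγ⟩ := tunedRuns_of_theorem2Statement h m
    obtain ⟨g₁, hg₁, hg⟩ := hγ γ₀ hγ₀ le_rfl
    refine ⟨g₁, hg₁, fun g hgpos hgle => ?_⟩
    obtain ⟨β, β', hβ, hββ', hK⟩ := hg g hgpos hgle
    refine ⟨β, β', hβ, hββ', fun K => ?_⟩
    obtain ⟨g₀, hI, hend, hD⟩ := hK K
    exact ⟨g₀, fun k hk => (hI k hk).1, hend, hD⟩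
  · intro h m
    obtain ⟨g₁, hg₁, hg⟩ := h m
    refine ⟨g₁, hg₁, fun γ hγ hγle => ⟨γ, hγ, fun g hgpos hgle => ?_⟩⟩
    obtain ⟨β, β', hβ, hββ', hK⟩ := hg g hgpos (hgle.trans hγle)
    refine ⟨β, β', hβ, hββ', fun K => ?_⟩
    obtain ⟨g₀, hpos, hend, hD⟩ := hK K
    have hb : 0 ≤ β * Real.log S.L := (mul_pos hβ hlog).le
    refine ⟨g₀, ?_, ?_, ?_⟩
    · show Step.InInterval γ K (S.cpl ⟨K, m, g₀⟩)
      exact fun k hk => ⟨hpos k hk, (le_final_of_discrete031_lower hD hb hgpos hk (hpos k hk)).trans hgle⟩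
    · show S.cpl ⟨K, m, g₀⟩ K = g
      exact hend
    · rw [Step.logRunning_iff_discrete031]
      exact hD

/-! ## §4 Theorem 2's FIRST SENTENCE on the carrier from partial-sum positivity (the weakest located letter) -/

/-- **THE FIRST SENTENCE OF THEOREM 2, WITH (0.20) AND A DEFECTED (0.31), FROM PARTIAL-SUM POSITIVITY.**  For every setting with the printed
`Definitions` ((0.18), (0.20)): if the history-dependent β-functions are jointly continuous on the boxes ]0, γ₀]^{k+1}, bounded above by β′ ≥ 0
there, and have PARTIAL SUMS `Σ_{j∈[k,n)} β_{j+1}(g₀, …, g_j) ≥ −M` along every history in ]0, γ₀] (`FlowStepRuns.BetaPartialSumsLowerH M γ₀ S.β` —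
the located unprinted input in its weakest form; no sign of β is assumed), then for every γ ∈ ]0, γ₀], every g > 0 with `1∕γ² + M ≤ 1∕g²` and
every K there is a bare coupling g₀ whose run (K, m, g₀) lies in ]0, γ], ends at g_K = g, OBEYS (0.20) at its own histories (`FlowStep.RGEqH` —
derived: forward uniqueness identifies the run with the shooting trajectory), and satisfies `1∕g² − M ≤ 1∕g_k² ≤ 1∕g² + β′(K − k)` for k ≤ K.
(`FlowStepRuns.couplingTrajectory_exists_partialSums` + `FlowStepRuns.flow_eq_of_rgEqH`, fed by `d018` ∕ `d020`.)  A REDUCTION; nothing of [I]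
asserted. [cite: Balaban1987RG1, Thm 2 p.259 (first sentence) with (0.18)–(0.20) pp.255–256 and p.298] -/
theorem firstSentence_of_partialSums (hD : Definitions S) {γ₀ M β' : ℝ} (hM : 0 ≤ M) (hβ' : 0 ≤ β')
    (hcont : BetaContH γ₀ S.β) (hps : BetaPartialSumsLowerH M γ₀ S.β) (hup : BetaUpperH β' γ₀ S.β) (m : ℕ) {γ : ℝ}
    (hγ : 0 < γ) (hγle : γ ≤ γ₀) {g : ℝ} (hg : 0 < g) (hgM : 1 / γ ^ 2 + M ≤ 1 / g ^ 2) (K : ℕ) :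
    ∃ g₀ : ℝ, Step.InInterval γ K (S.cpl ⟨K, m, g₀⟩) ∧ S.cpl ⟨K, m, g₀⟩ K = g ∧
      FlowStep.RGEqH K S.β (S.cpl ⟨K, m, g₀⟩) ∧
      ∀ k, k ≤ K → 1 / g ^ 2 - M ≤ 1 / (S.cpl ⟨K, m, g₀⟩ k) ^ 2 ∧
        1 / (S.cpl ⟨K, m, g₀⟩ k) ^ 2 ≤ 1 / g ^ 2 + β' * ((K : ℝ) - k) := by
  have hcont' : BetaContH γ S.β := fun k => (hcont k).mono (box_mono hγle k)
  have hup' : BetaUpperH β' γ S.β := fun k v hv => hup k v (box_mono hγle k hv)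
  obtain ⟨gs, hgsK, hrg, hI, hbd⟩ := couplingTrajectory_exists_partialSums S.β hγ hM hβ' hcont'
    (betaPartialSumsLowerH_mono hγle hps) hup' K g hg hgM
  have hstep : ∀ k, k < K → (∀ i, i ≤ k → 0 < S.cpl ⟨K, m, gs 0⟩ i) →
      0 < 1 / (S.cpl ⟨K, m, gs 0⟩ k) ^ 2 - S.β k (prefixOf (S.cpl ⟨K, m, gs 0⟩) k) →
        0 < S.cpl ⟨K, m, gs 0⟩ (k + 1) ∧ 1 / (S.cpl ⟨K, m, gs 0⟩ (k + 1)) ^ 2 =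
          1 / (S.cpl ⟨K, m, gs 0⟩ k) ^ 2 - S.β k (prefixOf (S.cpl ⟨K, m, gs 0⟩) k) := by
    intro k hk hpos hrhs
    obtain ⟨h1, h2⟩ := hD.d020 ⟨K, m, gs 0⟩ k hk hpos hrhs
    exact ⟨h1, by linarith⟩
  have heq : ∀ k, k ≤ K → S.cpl ⟨K, m, gs 0⟩ k = gs k :=
    flow_eq_of_rgEqH ⟨S.cpl ⟨K, m, gs 0⟩, fun _ _ => 0⟩ S.β K hstep (hD.d018 ⟨K, m, gs 0⟩) hrg fun k hk => (hI k hk).1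
  have hpre : ∀ k, k ≤ K → prefixOf (S.cpl ⟨K, m, gs 0⟩) k = prefixOf gs k := fun k hk =>
    funext fun i => heq i ((Nat.lt_succ_iff.mp i.isLt).trans hk)
  refine ⟨gs 0, fun k hk => ?_, ?_, fun k hk => ?_, fun k hk => ?_⟩
  · rw [heq k hk]; exact hI k hk
  · rw [heq K le_rfl]; exact hgsK
  · rw [heq k hk.le, heq (k + 1) hk, hpre k hk.le]; exact hrg k hk
  · rw [heq k hk]; exact hbd k hk

/-- **… in Theorem 2's quantifier shape**: under the same letters, for every γ ∈ ]0, γ₀] there is g₁ := (1∕γ² + M)^{−1∕2} > 0 such that for every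
g ∈ ]0, g₁] and every K some bare coupling g₀ = g₀(ε, g) gives a run in ]0, γ] ending at g_K = g, with (0.20) along it and the defected running
`1∕g² − M ≤ 1∕g_k² ≤ 1∕g² + β′(K − k)` — [I] Theorem 2's FIRST SENTENCE on the as-printed carrier (the construction-level twin is
`FlowStepRuns.endpointExistence_of_partialSums`). [cite: Balaban1987RG1, Thm 2 p.259 (first sentence)] -/
theorem endpoint_of_partialSums (hD : Definitions S) {γ₀ M β' : ℝ} (hM : 0 ≤ M) (hβ' : 0 ≤ β')
    (hcont : BetaContH γ₀ S.β) (hps : BetaPartialSumsLowerH M γ₀ S.β) (hup : BetaUpperH β' γ₀ S.β) (m : ℕ) :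
    ∀ γ : ℝ, 0 < γ → γ ≤ γ₀ → ∃ g₁ : ℝ, 0 < g₁ ∧ ∀ g : ℝ, 0 < g → g ≤ g₁ → ∀ K : ℕ, ∃ g₀ : ℝ,
      Step.InInterval γ K (S.cpl ⟨K, m, g₀⟩) ∧ S.cpl ⟨K, m, g₀⟩ K = g ∧ FlowStep.RGEqH K S.β (S.cpl ⟨K, m, g₀⟩) ∧
        ∀ k, k ≤ K → 1 / g ^ 2 - M ≤ 1 / (S.cpl ⟨K, m, g₀⟩ k) ^ 2 ∧
          1 / (S.cpl ⟨K, m, g₀⟩ k) ^ 2 ≤ 1 / g ^ 2 + β' * ((K : ℝ) - k) := by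
  intro γ hγ hγle
  set g₁ : ℝ := 1 / Real.sqrt (1 / γ ^ 2 + M) with hg₁
  have hg₁pos : 0 < g₁ := by positivity
  refine ⟨g₁, hg₁pos, fun g hg hgle K => ?_⟩
  have hgs : 1 / g₁ ^ 2 = 1 / γ ^ 2 + M := by
    rw [hg₁, div_pow, one_pow, Real.sq_sqrt (by positivity), one_div_one_div]
  have hgM : 1 / γ ^ 2 + M ≤ 1 / g ^ 2 := by
    rw [← hgs]
    exact one_div_le_one_div_of_le (by positivity) (pow_le_pow_left₀ hg.le hgle 2)
  exact firstSentence_of_partialSums hD hM hβ' hcont hps hup m hγ hγle hg hgM K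

/-- **… and from the SIGN**: `β_{k+1} ≥ 0` on the boxes ]0, γ₀]^{k+1} (`FlowStep.BetaLowerH 0 γ₀ S.β`, partial sums ≥ 0:
`FlowStepRuns.betaPartialSumsLowerH_of_sign`) + continuity + upper bound + `Definitions S` ⟹ for every γ ∈ ]0, γ₀], EVERY g ∈ ]0, γ] and every K a
bare coupling with the run in ]0, γ], g_K = g, (0.20) along it, and `g_k ≤ g` for all k ≤ K (the renormalized coupling bounds the whole run) —
Theorem 2's first sentence with g₁ = γ, no logarithmic running claimed. [cite: Balaban1987RG1, Thm 2 p.259 (first sentence); Balaban1989LargeFieldII, Thm 1 p.355] -/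
theorem endpoint_of_sign (hD : Definitions S) {γ₀ β' : ℝ} (hβ' : 0 ≤ β') (hcont : BetaContH γ₀ S.β)
    (hsign : BetaLowerH 0 γ₀ S.β) (hup : BetaUpperH β' γ₀ S.β) (m : ℕ) {γ : ℝ} (hγ : 0 < γ) (hγle : γ ≤ γ₀) {g : ℝ}
    (hg : 0 < g) (hgle : g ≤ γ) (K : ℕ) :
    ∃ g₀ : ℝ, Step.InInterval γ K (S.cpl ⟨K, m, g₀⟩) ∧ S.cpl ⟨K, m, g₀⟩ K = g ∧
      FlowStep.RGEqH K S.β (S.cpl ⟨K, m, g₀⟩) ∧ ∀ k, k ≤ K → S.cpl ⟨K, m, g₀⟩ k ≤ g := by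
  have hgM : 1 / γ ^ 2 + 0 ≤ 1 / g ^ 2 := by
    rw [add_zero]
    exact one_div_le_one_div_of_le (pow_pos hg 2) (pow_le_pow_left₀ hg.le hgle 2)
  obtain ⟨g₀, hI, hend, hrg, hbd⟩ := firstSentence_of_partialSums hD le_rfl hβ' hcont
    (betaPartialSumsLowerH_of_sign hsign) hup m hγ hγle hg hgM K
  refine ⟨g₀, hI, hend, hrg, fun k hk => ?_⟩
  have h1 : 1 / g ^ 2 ≤ 1 / (S.cpl ⟨K, m, g₀⟩ k) ^ 2 := by linarith [(hbd k hk).1]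
  have hpos : 0 < S.cpl ⟨K, m, g₀⟩ k := (hI k hk).1
  have h2 : (S.cpl ⟨K, m, g₀⟩ k) ^ 2 ≤ g ^ 2 := by rwa [one_div_le_one_div (pow_pos hg 2) (pow_pos hpos 2)] at h1
  exact (pow_le_pow_iff_left₀ hpos.le hg.le (by norm_num : (2 : ℕ) ≠ 0)).1 h2

/-! ## §5 Prover 1's binder `hrg` from the halting normalisation -/

/-- **(0.20) ALONG IN-INTERVAL RUNS, DERIVED from `d020` + the halting normalisation.**  If the coupling table HALTS OUTSIDE — wherever, after a
positive history, `1∕g_k² − β_{k+1}(g₀, …, g_k) ≤ 0` ((0.20) has no positive solution), the table's next value is non-positive (the carrier-level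
form of `FlowStepRuns.HaltsOutside`; print runs the recursion only under «0 < g_k ≦ γ», so this is a typing convention for runs print does not
discuss) — then every run lying in some ]0, γ] up to K obeys the history recursion (0.20) at its own histories: at each step the right side
must be positive (else g_{k+1} ≤ 0), so `Definitions.d020` applies. [cite: Balaban1987RG1, (0.20) p.256 with Thm 3 p.264 («0 < g_k ≦ γ»)] -/
theorem rgEqH_of_inInterval_of_halts (hD : Definitions S)
    (hhalt : ∀ (P : B12.RunParams) (k : ℕ), k < P.K → (∀ i, i ≤ k → 0 < S.cpl P i) →
      1 / (S.cpl P k) ^ 2 - S.β k (prefixOf (S.cpl P) k) ≤ 0 → S.cpl P (k + 1) ≤ 0)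
    (P : B12.RunParams) {γ : ℝ} (hI : Step.InInterval γ P.K (S.cpl P)) : FlowStep.RGEqH P.K S.β (S.cpl P) := by
  intro k hk
  have hposAll : ∀ i, i ≤ k → 0 < S.cpl P i := fun i hi => (hI i (hi.trans hk.le)).1
  by_cases hrhs : 0 < 1 / (S.cpl P k) ^ 2 - S.β k (prefixOf (S.cpl P) k)
  · exact (hD.d020 P k hk hposAll hrhs).2
  · exact absurd (hI (k + 1) (Nat.succ_le_of_lt hk)).1 (not_lt.mpr (hhalt P k hk hposAll (not_lt.mp hrhs)))

/-- **Prover 1's located binder `hrg` («inside the interval ]0, γ] the construction's couplings obey (0.20)», `…B12AsPrintedTuned`) HOLDS under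
`Definitions S` + the halting normalisation.** [cite: Balaban1987RG1, (0.20) p.256] -/
theorem hrg_of_halts (hD : Definitions S)
    (hhalt : ∀ (P : B12.RunParams) (k : ℕ), k < P.K → (∀ i, i ≤ k → 0 < S.cpl P i) →
      1 / (S.cpl P k) ^ 2 - S.β k (prefixOf (S.cpl P) k) ≤ 0 → S.cpl P (k + 1) ≤ 0) :
    ∀ P : B12.RunParams, Step.InInterval S.γ P.K (S.cpl P) → FlowStep.RGEqH P.K S.β (S.cpl P) :=
  fun P hI => rgEqH_of_inInterval_of_halts hD hhalt P hI

/-- **Part 1's necessity headline under the halting clause**: `Theorem2Statement S hL` + `Definitions ∧ Conclusions` + `hhalt` ⟹ along every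
tuned run (a run Theorem 3 speaks of, ending at g), every suffix sum of β_{j+1}(g₀, …, g_j) from k is ≥ β ln L·(K − k), with 0 < β ln L ≤ β′₅₁₀
(`…B12AsPrintedLower.theorem2Statement_forces_af_steps` with `hrg := hrg_of_halts`; the density statement is dropped here for brevity, it holds
verbatim). [cite: Balaban1987RG1, Thm 2 (0.31) p.259 with (0.20) p.256 and Thm 3 p.264] -/
theorem theorem2Statement_forces_suffix_of_halts {hL : Odd S.L ∧ 1 < S.L} (h : Theorem2Statement S hL) (hD : Definitions S)
    (hC : Conclusions S)
    (hhalt : ∀ (P : B12.RunParams) (k : ℕ), k < P.K → (∀ i, i ≤ k → 0 < S.cpl P i) →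
      1 / (S.cpl P k) ^ 2 - S.β k (prefixOf (S.cpl P) k) ≤ 0 → S.cpl P (k + 1) ≤ 0) (m : ℕ) :
    ∃ γ₀ : ℝ, 0 < γ₀ ∧ ∀ γ : ℝ, 0 < γ → γ ≤ γ₀ → γ ≤ S.γ → ∃ g₁ : ℝ, 0 < g₁ ∧ ∀ g : ℝ, 0 < g → g ≤ g₁ →
      ∃ β : ℝ, 0 < β ∧ β * Real.log S.L ≤ betaPrime510 4 (S.C510 * S.E₀) S.δ₁ ∧ ∀ K : ℕ, ∃ g₀ : ℝ,
        RunHyp S ⟨K, m, g₀⟩ ∧ S.cpl ⟨K, m, g₀⟩ K = g ∧ ∀ k, k ≤ K →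
          β * Real.log S.L * ((K : ℝ) - k) ≤ ∑ j ∈ Finset.Ico k K, S.β j (prefixOf (S.cpl ⟨K, m, g₀⟩) j) := by
  obtain ⟨γ₀, hγ₀, hγ⟩ := theorem2Statement_forces_af_steps h (hrg_of_halts hD hhalt) hD hC m
  refine ⟨γ₀, hγ₀, fun γ hγpos hγle hγS => ?_⟩
  obtain ⟨g₁, hg₁, hg⟩ := hγ γ hγpos hγle hγS
  refine ⟨g₁, hg₁, fun g hgpos hgle => ?_⟩
  obtain ⟨β, hβ, hrate, hK⟩ := hg g hgpos hgle
  refine ⟨β, hβ, hrate, fun K => ?_⟩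
  obtain ⟨g₀, hR, hend, hk⟩ := hK K
  exact ⟨g₀, hR, hend, fun k hk' => (hk k hk').1⟩

end

end Summit.QuantumFields.BalabanUV.Beta.EriceFlowEnclosureB12AsPrintedLowerEnd
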